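import Mathlib
import HarnessLib
import Literature.MathematicalPhysics.KineticTheory.HardSphereEuler
import Literature.MathematicalPhysics.KineticTheory.BackwardCluster
import Literature.MathematicalPhysics.KineticTheory.GoodConfigurations
import Literature.MathematicalPhysics.KineticTheory.HardSphereDisplacementPathLength

/-!
# Stub `stub_chainSpanBudget` of the line `Sketch` (log-window-tagged-tail) for the crux
`RelayRaceLocality.GibbsLightCone` (stmt-AtomisticToContinuum-12501)

Registered stub of the lead prover's reshaped skeleton (`Cruxes/GibbsLightCone/Lines/Sketch.lean`,
revision 4): the CHAIN SPAN BUDGET — deterministic kinematics on one good orbit of a hard-sphere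
flow on `𝕋³`. Along a collision chain with `k` links — carrier `q m` holds the baton on the time
interval `[T m, T (m+1)]`, and consecutive carriers `q m`, `q (m+1)` are in contact at the hand-over
time `T (m+1)`, `m < k`, the hand-over times being monotone — the minimal-image distance between the
first carrier at time `T 0` and the last carrier at time `T (k+1)` is at most the baton's total path
length `Σ_m ∫_{T m}^{T (m+1)} ‖v_{q m}‖` plus `k` contact offsets `ε`. Ingredients: displacement of
one particle ≤ its path length (`HardSphereFlow.euclidDist_flow_le_integral_norm_vel_comm`, tree),
contact = minimal-image distance exactly `ε` (`mem_contactPairSet`, `mem_contactSet`,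
`Torus.norm_geometry_sepVec`), and the triangle inequality (`torus_euclidDist_triangle`); induction
on the number of links, peeling the last carrier (`Fin.sum_univ_castSucc`).

This is the deterministic half of "span ≤ additive functional along ONE baton path", on which every
proposed proof of the kinetic-scale stub (spine eigenvalue / many-to-one, uniform baton, restart
induction) hangs. References: APST 2015 §5 (collision sequences of the backward cluster);
GST 2013 §4.1 (hard-sphere trajectories are piecewise free flight).
-/

namespace Summit.AtomisticToContinuum.HydrodynamicLimit.Theorems.LogWindowTaggedTail

open Literature.MathematicalPhysics.KineticTheory Literature.Analysis.FluidPDE MeasureTheory Filter Set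

open scoped BigOperators

/-- Two particles whose unordered pair belongs to the event of a configuration are at minimal-image
distance exactly `ε` on `𝕋³`. [folklore] -/
theorem chainSpanBudget_euclidDist_eq_of_mem_contactPairSet {N : ℕ} {ε : ℝ}
    {w : Config N (Fin 3) T3} {j l : Fin N}
    (h : s(j, l) ∈ contactPairSet (Torus.geometry (Fin 3)) ε w) :
    Torus.euclidDist (w j).1 (w l).1 = ε := by
  obtain ⟨-, hc | hc⟩ := mem_contactPairSet.1 h
  · exact (mem_contactSet.1 hc).2
  · rw [Torus.euclidDist_comm]
    exact (mem_contactSet.1 hc).2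

/-- CHAIN SPAN BUDGET (registered stub `stub_chainSpanBudget` of the line `Sketch` for the crux
`GibbsLightCone`, stmt-AtomisticToContinuum-12501; deterministic kinematics on a good orbit): along
a collision chain with `k` links — carrier `q m` holds the baton on `[T m, T (m+1)]`, consecutive
carriers are in contact at the hand-over times `T (m+1)`, `m < k`, `T` monotone — the minimal-image
distance from the first carrier's position at time `T 0` to the last carrier's position at time
`T (k+1)` is at most the total path length of the baton plus `k` contact offsets `ε`. [folklore] -/
theorem stub_chainSpanBudget :
    ∀ (N : ℕ) (ε : ℝ) (Φ : HardSphereFlow (Torus.geometry (Fin 3)) ε N) (z : Config N (Fin 3) T3),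
    z ∈ Φ.good → ∀ (k : ℕ) (q : Fin (k + 1) → Fin N) (T : Fin (k + 2) → ℝ), Monotone T →
      (∀ m : Fin k, s(q (Fin.castSucc m), q (Fin.succ m)) ∈
        contactPairSet (Torus.geometry (Fin 3)) ε (Φ.flow (T (Fin.castSucc (Fin.succ m))) z)) →
      Torus.euclidDist ((Φ.flow (T 0) z) (q 0)).1
          ((Φ.flow (T (Fin.last (k + 1))) z) (q (Fin.last k))).1 ≤
        (∑ m : Fin (k + 1), ∫ u in T (Fin.castSucc m)..T (Fin.succ m), ‖((Φ.flow u z) (q m)).2‖) +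
          k * ε := by
  intro N ε Φ z hz k
  induction k with
  | zero =>
    intro q T hT _
    rw [Fin.sum_univ_one, Nat.cast_zero, zero_mul, add_zero]
    exact Φ.euclidDist_flow_le_integral_norm_vel_comm hz (q 0) (hT (Fin.zero_le _))
  | succ k ih =>
    intro q T hT hlink
    -- the chain without its last link
    have ih' := ih (fun m => q (Fin.castSucc m)) (fun i => T (Fin.castSucc i))
      (fun i j hij => hT (by simpa using hij)) (fun m => by
        simpa only [Fin.castSucc_succ] using hlink (Fin.castSucc m))
    simp only [Fin.castSucc_zero] at ih'
    -- the last hand-over: carriers `q k` and `q (k+1)` touch at time `T (k+1)`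
    have hcontact : Torus.euclidDist
        ((Φ.flow (T (Fin.castSucc (Fin.last (k + 1)))) z) (q (Fin.castSucc (Fin.last k)))).1
        ((Φ.flow (T (Fin.castSucc (Fin.last (k + 1)))) z) (q (Fin.last (k + 1)))).1 = ε := by
      have h := hlink (Fin.last k)
      rw [Fin.succ_last] at h
      exact chainSpanBudget_euclidDist_eq_of_mem_contactPairSet h
    -- the last carrier's displacement is at most its path length
    have hlastle : T (Fin.castSucc (Fin.last (k + 1))) ≤ T (Fin.last (k + 2)) :=
      hT (Fin.castSucc_lt_last _).le
    have hdisp := Φ.euclidDist_flow_le_integral_norm_vel_comm hz (q (Fin.last (k + 1))) hlastle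
    -- bookkeeping
    rw [Fin.sum_univ_castSucc, Fin.succ_last, Nat.cast_succ, add_mul, one_mul]
    simp only [Fin.castSucc_succ] at ih' ⊢
    have htri₁ := torus_euclidDist_triangle ((Φ.flow (T 0) z) (q 0)).1
      ((Φ.flow (T (Fin.castSucc (Fin.last (k + 1)))) z) (q (Fin.castSucc (Fin.last k)))).1
      ((Φ.flow (T (Fin.last (k + 2))) z) (q (Fin.last (k + 1)))).1
    have htri₂ := torus_euclidDist_triangle
      ((Φ.flow (T (Fin.castSucc (Fin.last (k + 1)))) z) (q (Fin.castSucc (Fin.last k)))).1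
      ((Φ.flow (T (Fin.castSucc (Fin.last (k + 1)))) z) (q (Fin.last (k + 1)))).1
      ((Φ.flow (T (Fin.last (k + 2))) z) (q (Fin.last (k + 1)))).1
    rw [hcontact] at htri₂
    linarith

end Summit.AtomisticToContinuum.HydrodynamicLimit.Theorems.LogWindowTaggedTail
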